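import Mathlib
import Summits.ValiantsHypothesis.ValiantsHypothesis.Theorems.BarrierLeverPartitionMinorsHitByVPHiddenStatesFirstShellAnyH

/-!
# Route BarrierLever — item `PartitionMinorsHitByVP` (stmt-ValiantsHypothesis-19717), line `hidden-states`:
# FULLY PRESCRIBED TRANSPORTS and the rows of a path table (toolkit for the oriented second-shell cells)

Helper file (`--supports stmt-ValiantsHypothesis-19717`; cell valiant-natproofs, 𝒟-side door (c), registered line
`Cruxes/PartitionMinorsHitByVP/Lines/hidden_states.lean` v8; prover seat val-np-p6 gen 18).  Closes NO item; definition-free.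

CONTENTS.  ★ `exists_equiv_prescribed` — a transport `(Fin (k+1) ⊕ Fin k) ⊕ (Fin j ⊕ Fin j') ≃ α` onto `C∖A, A∖C, A∩C, (A∪C)ᶜ`
whose Y-path `p ↦ e (inl (inl p))` and attachments `i ↦ e (inl (inr i))` are PRESCRIBED injective enumerations (gen 17's
`exists_equiv_four_oriented` prescribes only top, bottom and the two level-0 attachments; cancellation cells whose two paths must
run through common nodes IN THE SAME ORDER — the parallel nested cell — need every position).  The entries of a path row in closed
form: `swapTable'_path_path` (diagonal `1`, the node just below `1`, else `0`), `swapTable'_path_att` (`1` exactly at the attachments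
of its level), and the source lemma `swapTable'_path_row_ne_zero`; small injectivity lemmas `injective_vec2/3` for `![…]`
(`injective_vec4` is `Literature.Computability.AlgebraicComplexity.injective_vec4`).

HONEST LABEL: conjecture-column toolkit (second shell, every `t, h`); 19717 stays OPEN; nothing on crux 14610 or VP ≠ VNP.
-/

set_option linter.dupNamespace false

namespace Summit.ValiantsHypothesis.ValiantsHypothesis.Theorems.BarrierLever.HiddenStates

open Finset

noncomputable section

namespace SecondShell

open PathTable

variable {α : Type} [Fintype α] [DecidableEq α]

/-! ## Fully prescribed transports and the rows of a path table -/

/-- ★ **fully prescribed transport**: the Y-path and the attachments in a prescribed order. -/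
theorem exists_equiv_prescribed (A C : Finset α) {k j j' : ℕ}
    (h1 : (C \ A).card = k + 1) (h2 : (A \ C).card = k) (h3 : (A ∩ C).card = j) (h4 : (A ∪ C)ᶜ.card = j')
    (py : Fin (k + 1) → α) (hpy : Function.Injective py) (hpyY : ∀ p, py p ∈ C \ A)
    (px : Fin k → α) (hpx : Function.Injective px) (hpxX : ∀ i, px i ∈ A \ C) :
    ∃ e : (Fin (k + 1) ⊕ Fin k) ⊕ (Fin j ⊕ Fin j') ≃ α,
      (∀ x, e (Sum.inl (Sum.inl x)) ∈ C \ A) ∧ (∀ i, e (Sum.inl (Sum.inr i)) ∈ A \ C) ∧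
      (∀ z, e (Sum.inr (Sum.inl z)) ∈ A ∩ C) ∧ (∀ w, e (Sum.inr (Sum.inr w)) ∈ (A ∪ C)ᶜ) ∧
      (∀ p, e (Sum.inl (Sum.inl p)) = py p) ∧ (∀ i, e (Sum.inl (Sum.inr i)) = px i) := by
  classical
  obtain ⟨e, m1, m2, m3, m4⟩ := exists_equiv_four' A C h1 h2 h3 h4
  have hYblock : ∀ x : α, x ∈ C \ A → ∃ i, e.symm x = Sum.inl (Sum.inl i) := by
    intro x hx
    rcases hex : e.symm x with (i | i) | (z | w')
    · exact ⟨i, rfl⟩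
    · exfalso; have := m2 i; rw [← hex, Equiv.apply_symm_apply] at this
      rw [Finset.mem_sdiff] at hx this; exact this.2 hx.1
    · exfalso; have := m3 z; rw [← hex, Equiv.apply_symm_apply] at this
      rw [Finset.mem_sdiff] at hx; rw [Finset.mem_inter] at this; exact hx.2 this.1
    · exfalso; have := m4 w'; rw [← hex, Equiv.apply_symm_apply] at this
      rw [Finset.mem_sdiff] at hx; rw [Finset.mem_compl, Finset.mem_union] at this; exact this (Or.inr hx.1)
  have hXblock : ∀ x : α, x ∈ A \ C → ∃ i, e.symm x = Sum.inl (Sum.inr i) := by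
    intro x hx
    rcases hex : e.symm x with (i | i) | (z | w')
    · exfalso; have := m1 i; rw [← hex, Equiv.apply_symm_apply] at this
      rw [Finset.mem_sdiff] at hx this; exact this.2 hx.1
    · exact ⟨i, rfl⟩
    · exfalso; have := m3 z; rw [← hex, Equiv.apply_symm_apply] at this
      rw [Finset.mem_sdiff] at hx; rw [Finset.mem_inter] at this; exact hx.2 this.2
    · exfalso; have := m4 w'; rw [← hex, Equiv.apply_symm_apply] at this
      rw [Finset.mem_sdiff] at hx; rw [Finset.mem_compl, Finset.mem_union] at this; exact this (Or.inl hx.1)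
  choose gy hgy using fun p => hYblock (py p) (hpyY p)
  choose gx hgx using fun i => hXblock (px i) (hpxX i)
  have hgyinj : Function.Injective gy := by
    intro p p' h
    apply hpy
    apply e.symm.injective
    rw [hgy p, hgy p', h]
  have hgxinj : Function.Injective gx := by
    intro i i' h
    apply hpx
    apply e.symm.injective
    rw [hgx i, hgx i', h]
  let σ : Equiv.Perm (Fin (k + 1)) := Equiv.ofBijective gy (Finite.injective_iff_bijective.1 hgyinj)
  let ρ : Equiv.Perm (Fin k) := Equiv.ofBijective gx (Finite.injective_iff_bijective.1 hgxinj)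
  let e' : (Fin (k + 1) ⊕ Fin k) ⊕ (Fin j ⊕ Fin j') ≃ α :=
    (Equiv.sumCongr (Equiv.sumCongr σ ρ) (Equiv.refl (Fin j ⊕ Fin j'))).trans e
  have he' : ∀ x, e' x = e (Sum.map (Sum.map σ ρ) id x) := fun x => rfl
  refine ⟨e', fun x => ?_, fun i => ?_, fun z => ?_, fun w' => ?_, fun p => ?_, fun i => ?_⟩
  · rw [he']; exact m1 (σ x)
  · rw [he']; exact m2 (ρ i)
  · rw [he']; exact m3 z
  · rw [he']; exact m4 w'
  · rw [he']
    show e (Sum.inl (Sum.inl (gy p))) = py p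
    rw [← hgy p, Equiv.apply_symm_apply]
  · rw [he']
    show e (Sum.inl (Sum.inr (gx i))) = px i
    rw [← hgx i, Equiv.apply_symm_apply]

omit [Fintype α] [DecidableEq α] in
/-- the entries of a path row at the path nodes: `1` on the diagonal, `1` (weight `s = 1`) at the node just below, else `0`. -/
theorem swapTable'_path_path {k j j' : ℕ} (e : (Fin (k + 1) ⊕ Fin k) ⊕ (Fin j ⊕ Fin j') ≃ α) (p p' : Fin (k + 1)) :
    swapTable' e (e (Sum.inl (Sum.inl p))) (e (Sum.inl (Sum.inl p'))) =
      if p' = p then 1 else if (p' : ℕ) + 1 = p then 1 else 0 := by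
  simp only [swapTable', Equiv.symm_apply_apply, coreTable', pw]

omit [Fintype α] [DecidableEq α] in
/-- the entries of a path row at the attachments: `1` exactly at the attachments of its own level. -/
theorem swapTable'_path_att {k j j' : ℕ} (e : (Fin (k + 1) ⊕ Fin k) ⊕ (Fin j ⊕ Fin j') ≃ α) (p : Fin (k + 1)) (i : Fin k) :
    swapTable' e (e (Sum.inl (Sum.inl p))) (e (Sum.inl (Sum.inr i))) = if lvlX k i = p then 1 else 0 := by
  simp only [swapTable', Equiv.symm_apply_apply, coreTable', pw]

omit [Fintype α] [DecidableEq α] in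
/-- **the sources of a path node**: a nonzero off-diagonal entry of the row of the node at position `p` sits at the node
just below or at an attachment of level `p`. -/
theorem swapTable'_path_row_ne_zero {k j j' : ℕ} (e : (Fin (k + 1) ⊕ Fin k) ⊕ (Fin j ⊕ Fin j') ≃ α) (p : Fin (k + 1))
    {d : α} (hd : swapTable' e (e (Sum.inl (Sum.inl p))) d ≠ 0) (hne : d ≠ e (Sum.inl (Sum.inl p))) :
    (∃ p' : Fin (k + 1), (p' : ℕ) + 1 = p ∧ d = e (Sum.inl (Sum.inl p'))) ∨
      (∃ i : Fin k, lvlX k i = p ∧ d = e (Sum.inl (Sum.inr i))) := by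
  obtain ⟨c, rfl⟩ := e.surjective d
  rcases c with (p' | i) | z
  · left
    refine ⟨p', ?_, rfl⟩
    rw [swapTable'_path_path] at hd
    by_cases h1 : p' = p
    · exact absurd (by rw [h1]) hne
    · rw [if_neg h1] at hd
      by_contra h2
      exact hd (if_neg h2)
  · right
    refine ⟨i, ?_, rfl⟩
    rw [swapTable'_path_att] at hd
    by_contra h2
    exact hd (if_neg h2)
  · exfalso; apply hd
    simp [swapTable', coreTable']


omit [Fintype α] [DecidableEq α] in
/-- two distinct entries give an injective vector. -/
theorem injective_vec2 {a b : α} (hab : a ≠ b) : Function.Injective ![a, b] := by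
  intro i i' h
  fin_cases i <;> fin_cases i' <;> simp_all

omit [Fintype α] [DecidableEq α] in
/-- three pairwise distinct entries give an injective vector. -/
theorem injective_vec3 {a b c : α} (hab : a ≠ b) (hac : a ≠ c) (hbc : b ≠ c) : Function.Injective ![a, b, c] := by
  intro i i' h
  fin_cases i <;> fin_cases i' <;> simp_all

end SecondShell

end

end Summit.ValiantsHypothesis.ValiantsHypothesis.Theorems.BarrierLever.HiddenStates
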